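import Mathlib
import HarnessLib
import Summits.ValiantsHypothesis.ValiantsHypothesis.Theorems.LacunarySymmetroidMatrixDescartesProductPlusOneSeparatingWeightUpperSigned

/-!
# ValiantsHypothesis / LacunarySymmetroid — crux `MatrixDescartes` (stmt-ValiantsHypothesis-18050, V1),
# LINE (A) «product_plus_one», floor `OneChangeFloorK3`: the RATIO-ORDERED SECTOR IN THE FLOOR'S OWN CURRENCY

The headline sector of ✓ `…SeparatingWeight` (`sepWeight_ratioOrdered_incoherent`, normalised chart) restated through the every-`K`
theorem ✓ `sepWeight_meanOrdered_upperSigned_le` in EXACTLY the shape of the floor `OneChangeFloorK3` (skeleton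
`Cruxes/MatrixDescartes/Lines/product_plus_one.lean`): general support `d 0 < d 1 < d 2`, coefficient table `a : Fin m → Fin 3 → ℝ`,
bottom coupling, `eulerNumerator d a 0` unfolded def-free (`Σ_j (Σ_l C(a j l·(d l − d 0)) X^{d l})·∏_{i≠j} (Σ_l C(a i l) X^{d l})`).

* `sepWeight_meanOrder_of_ratioOrder` — for `K = 3` the tilted gap-means of two incoherent rows are ordered iff their middle/top ratios are:
  `B⁽²⁾_j B_i − B⁽²⁾_i B_j = (d₁−d₀)(d₂−d₀)(d₂−d₁)·x^{d₁+d₂}·(a_{i1}a_{j2} − a_{j1}a_{i2})`;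
* ★★★ `sepWeight_ratioOrdered_floor` — FLOOR CURRENCY: a company of incoherent no-dip rows (`a_{j0} > 0`, `a_{j1}, a_{j2} < 0`; the
  floor's hypothesis `¬(a_{j0}a_{j1} < 0 ∧ a_{j1}a_{j2} < 0)` holds for them) on ANY support `d 0 < d 1 < d 2`, in which at every `x > 0`
  every switched row `j` (`f_j(x) < 0`) and unswitched row `i` (`f_i(x) > 0`) satisfy `a_{i1}·a_{j2} ≤ a_{j1}·a_{i2}`
  (`|a_{j1}|/|a_{j2}| ≥ |a_{i1}|/|a_{i2}|`), has `Z₊(eulerNumerator d a 0) ≤ m + (m + 1)` — the constant `C = 2` row of `OneChangeFloorK3`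
  on this sector, at every support ratio.

HONEST FRAMING: a sector of the research floor in its own currency; NOT `OneChangeFloorK3` (the order hypothesis is a genuine restriction),
not the other stubs, not `MatrixDescartes`; `VP ≠ VNP` is NOT proved.  No definitions, no named facts, no sorry.
-/

set_option linter.dupNamespace false

namespace Summit.ValiantsHypothesis.ValiantsHypothesis.Theorems.LacunarySymmetroidMatrixDescartes

namespace ProductPlusOne

open Polynomial Finset
open scoped BigOperators

/-- **Ratio order = mean order at `K = 3`**: with `B_j = Σ_l (d_l − d_0) a_{jl} x^{d_l}`, `B⁽²⁾_j = Σ_l (d_l − d_0)² a_{jl} x^{d_l}`,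
`B⁽²⁾_j·B_i − B⁽²⁾_i·B_j = (d₁−d₀)(d₂−d₀)(d₂−d₁)·x^{d₁}x^{d₂}·(a_{i1}a_{j2} − a_{j1}a_{i2})`. [this file's lemma] -/
theorem sepWeight_meanOrder_of_ratioOrder (d : Fin 3 → ℕ) (aj ai : Fin 3 → ℝ) (x : ℝ) :
    (∑ l, ((d l : ℝ) - d 0) ^ 2 * aj l * x ^ (d l)) * (∑ l, ((d l : ℝ) - d 0) * ai l * x ^ (d l))
        - (∑ l, ((d l : ℝ) - d 0) ^ 2 * ai l * x ^ (d l)) * (∑ l, ((d l : ℝ) - d 0) * aj l * x ^ (d l))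
      = ((d 1 : ℝ) - d 0) * ((d 2 : ℝ) - d 0) * ((d 2 : ℝ) - d 1) * (x ^ (d 1) * x ^ (d 2))
          * (ai 1 * aj 2 - aj 1 * ai 2) := by
  simp only [Fin.sum_univ_three]
  ring

/-- ★★★ **THE RATIO-ORDERED SECTOR IN FLOOR CURRENCY** (any support `d 0 < d 1 < d 2`, bottom coupling, incoherent no-dip rows
`a_{j0} > 0`, `a_{j1} < 0`, `a_{j2} < 0`): if at every `x > 0` every switched row `j` and unswitched row `i` satisfy
`a_{i1}·a_{j2} ≤ a_{j1}·a_{i2}`, then `Z₊(eulerNumerator d a 0) ≤ m + (m + 1)`. [this file's theorem] -/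
theorem sepWeight_ratioOrdered_floor {m : ℕ} (d : Fin 3 → ℕ) (h01 : d 0 < d 1) (h12 : d 1 < d 2) (a : Fin m → Fin 3 → ℝ)
    (hinc : ∀ j, 0 < a j 0 ∧ a j 1 < 0 ∧ a j 2 < 0)
    (hord : ∀ x : ℝ, 0 < x → ∀ j i,
      a j 0 * x ^ (d 0) + a j 1 * x ^ (d 1) + a j 2 * x ^ (d 2) < 0 →
      0 < a i 0 * x ^ (d 0) + a i 1 * x ^ (d 1) + a i 2 * x ^ (d 2) → a i 1 * a j 2 ≤ a j 1 * a i 2) :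
    ((∑ j, (∑ l, C (a j l * ((d l : ℝ) - d 0)) * X ^ (d l)) * ∏ i ∈ Finset.univ.erase j, (∑ l, C (a i l) * X ^ (d l))
        : ℝ[X]).roots.toFinset.filter (fun t => 0 < t)).card ≤ m + (m + 1) := by
  have h02 : d 0 < d 2 := h01.trans h12
  have hd : ∀ l : Fin 3, l ≠ 0 → d 0 < d l := by
    intro l hl
    fin_cases l
    · exact absurd rfl hl
    · exact h01
    · exact h02
  have hK : ∃ l : Fin 3, l ≠ 0 := ⟨1, by decide⟩
  have hup : ∀ j, 0 < a j 0 ∧ ∀ l : Fin 3, l ≠ 0 → a j l < 0 := by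
    intro j
    refine ⟨(hinc j).1, fun l hl => ?_⟩
    fin_cases l
    · exact absurd rfl hl
    · exact (hinc j).2.1
    · exact (hinc j).2.2
  refine sepWeight_meanOrdered_upperSigned_le d a 0 hd hK hup (fun z hz j i hj hi => ?_)
  have hj' : a j 0 * z ^ (d 0) + a j 1 * z ^ (d 1) + a j 2 * z ^ (d 2) < 0 := by
    simpa only [Fin.sum_univ_three] using hj
  have hi' : 0 < a i 0 * z ^ (d 0) + a i 1 * z ^ (d 1) + a i 2 * z ^ (d 2) := by
    simpa only [Fin.sum_univ_three] using hi
  have hle := hord z hz j i hj' hi'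
  have key := sepWeight_meanOrder_of_ratioOrder d (a j) (a i) z
  have h1 : 0 < ((d 1 : ℝ) - d 0) := sub_pos.mpr (by exact_mod_cast h01)
  have h2 : 0 < ((d 2 : ℝ) - d 0) := sub_pos.mpr (by exact_mod_cast h02)
  have h3 : 0 < ((d 2 : ℝ) - d 1) := sub_pos.mpr (by exact_mod_cast h12)
  have hx : 0 < z ^ (d 1) * z ^ (d 2) := by positivity
  have hcoef : 0 < ((d 1 : ℝ) - d 0) * ((d 2 : ℝ) - d 0) * ((d 2 : ℝ) - d 1) * (z ^ (d 1) * z ^ (d 2)) := by positivity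
  have hrhs : ((d 1 : ℝ) - d 0) * ((d 2 : ℝ) - d 0) * ((d 2 : ℝ) - d 1) * (z ^ (d 1) * z ^ (d 2))
      * (a i 1 * a j 2 - a j 1 * a i 2) ≤ 0 :=
    mul_nonpos_of_nonneg_of_nonpos hcoef.le (by linarith)
  linarith

end ProductPlusOne

end Summit.ValiantsHypothesis.ValiantsHypothesis.Theorems.LacunarySymmetroidMatrixDescartes
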